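import Mathlib
import Summits.ResolutionOfSingularities.ResolutionOfSingularities.Theorems.WeightedInvariantLocalWeightedDropNCResRegimesOfBudget
import Summits.ResolutionOfSingularities.ResolutionOfSingularities.Theorems.WeightedInvariantLocalWeightedDropNCResRegimeLetterAssemblyB
import Summits.ResolutionOfSingularities.ResolutionOfSingularities.Theorems.WeightedInvariantLocalWeightedDropTOT2BridgePresByStepB
import Summits.ResolutionOfSingularities.ResolutionOfSingularities.Theorems.WeightedInvariantLocalWeightedDropTOT2ConflictBudget
import Summits.ResolutionOfSingularities.ResolutionOfSingularities.Theorems.WeightedInvariantLocalWeightedDropNCResPhaseAssemblyB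

/-!
# `WeightedInvariant.LocalWeightedDrop` ENGINE, W′|₄ line — D₃ᴮ object (4): REGIMES (P) AND (L) IN B-PERMISSIBLE FORM, UNCONDITIONALLY

Sub-problem `ResolutionOfSingularities`, ENGINE crux `stmt-ResolutionOfSingularities-8899` (`LocalWeightedDrop`), registered stub W′|₄
`stub_wildWideApexFourStartsWon`; res-L1-w43-plan-1 RULING 2026-08-27T21:45:42Z (D₃ᴮ lane).  THE CLOSERS of the hypotheses `hP` and `hL` of
`surfaceBoundaryNC_of_regimesB` (…NCResPhaseAssemblyB): the B-assemblies `regimePresentedB_of_pieces` (…NCResRegimePresentedAssemblyB) /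
`regimeLetterB_of_pieces` (…NCResRegimeLetterAssemblyB) instantiated with the TREE pieces — the lazy selector `prepSelWP` (`isPrepRecentring_prepSelWP_all`),
res-type-088's conflict budget `stub_conflictBudget` (…TOT2ConflictBudget, res-L1-w43-stub-2) with its two laws, the entry `Decoration.exists_presBy_of_presented`,
the exit `Decoration.hCol_of_presBy_of_not_inPoly`, and the B-one-steps `Decoration.PresBy.exists_bmove_of_not_conflict` / `exists_bmove_point`
(…TOT2BridgePresByStepB).  [OURS · L1 W4.3 · chain w43 · res-L1-w43-lead-1 g6; def-free; B-twins of res-L1-w43-stub-2's …NCResRegimesOfBudget /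
the lead's …NCResRegimesOfBudgetEx; nothing here is a statement of any manuscript; AI-produced, gate-checked, weaker than expert review.]

* `regimePresentedB_of_pieces₂` — the `o`-drop step shapes (those the one-steps deliver) imply the `head`-drop shapes of `regimePresentedB_of_pieces`;
* `regimePresentedB_of_budget` / `regimeLetterB_of_budget` — regimes (P) / (L) in B-form modulo a budget with its two laws;
* **`regimePresentedB` / `regimeLetterB`** — UNCONDITIONAL, over an algebraically closed field of prime characteristic: the hypotheses `hP` / `hL` of
  `surfaceBoundaryNC_of_regimesB`, verbatim.
-/

set_option linter.dupNamespace false -- mandated namespace of this single-conjunct summit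

noncomputable section

namespace Summit.ResolutionOfSingularities.ResolutionOfSingularities.Theorems

namespace TameFourTupleDrop

open MvPowerSeries Literature.AlgebraicGeometry.Resolution PolyDescent

variable {k : Type} [Field k]

/-! ## The `o`-drop step shapes imply the `head`-drop shapes of regime (P), B-form -/

/-- **REGIME (P) IN B-FORM FROM ITS PIECES, `o`-drop step shapes** (an order drop is a head drop; the same head always hands over the presented successor). -/
theorem regimePresentedB_of_pieces₂ [Infinite k]
    (ψsel : (d : ℕ) → (Fin d → MvPowerSeries (Fin 2) k) → MvPowerSeries (Fin 2) k)
    (hsel : ∀ (d : ℕ) (X : Fin d → MvPowerSeries (Fin 2) k), IsPosT d X → IsPrepRecentring d X (ψsel d X))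
    (M : (d : ℕ) → (Fin d → MvPowerSeries (Fin 2) k) → Finset (Fin 2) → ℕ)
    (hM_succ : ∀ (d : ℕ) (A : Fin d → MvPowerSeries (Fin 2) k) (N : Finset (Fin 2)) (A' : Fin d → MvPowerSeries (Fin 2) k)
      (N' : Finset (Fin 2)),
      (∃ (b : MvPowerSeries (Fin (2 + 1)) k) (δ : Decoration k 2) (Θ : Fin (2 + 1) → MvPowerSeries (Fin (2 + 1)) k),
        Admissible b δ ∧ 2 ≤ δ.o ∧ δ.c = d ∧ δ.PresBy d A N Θ) →
      InPoly d A → InPoly d A' → SuccFamilySel d (ψsel d) A N A' N' → M d A' N' ≤ M d A N)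
    (hM_conf : ∀ (d : ℕ) (A : Fin d → MvPowerSeries (Fin 2) k) (N : Finset (Fin 2)) (A' : Fin d → MvPowerSeries (Fin 2) k)
      (N' : Finset (Fin 2)),
      (∃ (b : MvPowerSeries (Fin (2 + 1)) k) (δ : Decoration k 2) (Θ : Fin (2 + 1) → MvPowerSeries (Fin (2 + 1)) k),
        Admissible b δ ∧ 2 ≤ δ.o ∧ δ.c = d ∧ δ.PresBy d A N Θ) →
      InPoly d A → InPoly d A' → NCPoly.Conflict d A N → PointFamilySel d (ψsel d) A N A' N' → M d A' N' < M d A N)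
    (hP1 : ∀ (b : MvPowerSeries (Fin (2 + 1)) k) (δ : Decoration k 2), Admissible b δ → 2 ≤ δ.o → ¬ δ.HCol →
      (δ.O.Nonempty ∨ δ.GoodDir) →
      ∃ (A : Fin δ.c → MvPowerSeries (Fin 2) k) (N : Finset (Fin 2)) (Θ : Fin (2 + 1) → MvPowerSeries (Fin (2 + 1)) k),
        δ.PresBy δ.c A N Θ ∧ InPoly δ.c A)
    (hPx : ∀ (b : MvPowerSeries (Fin (2 + 1)) k) (δ : Decoration k 2) (d : ℕ) (A : Fin d → MvPowerSeries (Fin 2) k) (N : Finset (Fin 2))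
      (Θ : Fin (2 + 1) → MvPowerSeries (Fin (2 + 1)) k),
      Admissible b δ → 2 ≤ δ.o → δ.c = d → δ.PresBy d A N Θ → WellPrepared d A → ¬ InPoly d A → δ.HCol)
    (hP2' : ∀ (b : MvPowerSeries (Fin (2 + 1)) k) (δ : Decoration k 2) (d : ℕ) (A : Fin d → MvPowerSeries (Fin 2) k) (N : Finset (Fin 2))
      (Θ : Fin (2 + 1) → MvPowerSeries (Fin (2 + 1)) k),
      Admissible b δ → 2 ≤ δ.o → δ.c = d → δ.PresBy d A N Θ → InPoly d A → ¬ NCPoly.Conflict d A N →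
      ∃ (Φ : Fin (2 + 1) → MvPowerSeries (Fin (2 + 1)) k) (w : Fin (2 + 1) → ℕ), IsBPermissible δ Φ w ∧
        BMoveClause (b, δ) Φ w (fun τ' => Admissible τ'.1 τ'.2 ∧ (τ'.2.o < δ.o ∨ (τ'.2.head = δ.head ∧
          ∃ (A' : Fin d → MvPowerSeries (Fin 2) k) (N' : Finset (Fin 2)) (Θ' : Fin (2 + 1) → MvPowerSeries (Fin (2 + 1)) k),
            τ'.2.PresBy d A' N' Θ' ∧ WellPrepared d A' ∧ SuccFamilySel d (ψsel d) A N A' N'))))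
    (hP2c' : ∀ (b : MvPowerSeries (Fin (2 + 1)) k) (δ : Decoration k 2) (d : ℕ) (A : Fin d → MvPowerSeries (Fin 2) k) (N : Finset (Fin 2))
      (Θ : Fin (2 + 1) → MvPowerSeries (Fin (2 + 1)) k),
      Admissible b δ → 2 ≤ δ.o → δ.c = d → δ.PresBy d A N Θ → InPoly d A → NCPoly.Conflict d A N →
      ∃ (Φ : Fin (2 + 1) → MvPowerSeries (Fin (2 + 1)) k) (w : Fin (2 + 1) → ℕ), IsBPermissible δ Φ w ∧
        BMoveClause (b, δ) Φ w (fun τ' => Admissible τ'.1 τ'.2 ∧ (τ'.2.o < δ.o ∨ (τ'.2.head = δ.head ∧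
          ∃ (A' : Fin d → MvPowerSeries (Fin 2) k) (N' : Finset (Fin 2)) (Θ' : Fin (2 + 1) → MvPowerSeries (Fin (2 + 1)) k),
            τ'.2.PresBy d A' N' Θ' ∧ WellPrepared d A' ∧ PointFamilySel d (ψsel d) A N A' N'))))
    (b : MvPowerSeries (Fin (2 + 1)) k) (δ : Decoration k 2) (hadm : Admissible b δ) (ho : 2 ≤ δ.o) (hnc : ¬ δ.HCol)
    (hreg : δ.O.Nonempty ∨ δ.GoodDir) :
    DBWinsTo (fun τ : MvPowerSeries (Fin (2 + 1)) k × Decoration k 2 => Admissible τ.1 τ.2 ∧ (τ.2.head < δ.head ∨ (τ.2.head = δ.head ∧ τ.2.HCol)))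
      (b, δ) := by
  have hlt : ∀ δ δ' : Decoration k 2, δ'.o < δ.o → δ'.head < δ.head := fun δ δ' h => by
    rw [Decoration.head, Decoration.head, Prod.Lex.toLex_lt_toLex]; exact Or.inl h
  refine regimePresentedB_of_pieces ψsel hsel M hM_succ hM_conf hP1 hPx (fun b δ d A N Θ hadm ho hc hpres hin hconf => ?_)
    (fun b δ d A N Θ hadm ho hc hpres hin hconf => ?_) b δ hadm ho hnc hreg
  · obtain ⟨Φ, w, hmv, hcl⟩ := hP2' b δ d A N Θ hadm ho hc hpres hin hconf
    refine ⟨Φ, w, hmv, hcl.mono fun τ' ⟨hadm', hcase⟩ => ⟨hadm', ?_⟩⟩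
    exact hcase.imp (hlt δ τ'.2) fun h => ⟨h.1, Or.inr h.2⟩
  · obtain ⟨Φ, w, hmv, hcl⟩ := hP2c' b δ d A N Θ hadm ho hc hpres hin hconf
    refine ⟨Φ, w, hmv, hcl.mono fun τ' ⟨hadm', hcase⟩ => ⟨hadm', ?_⟩⟩
    exact hcase.imp (hlt δ τ'.2) fun h => ⟨h.1, Or.inr h.2⟩

/-! ## Regimes (P) and (L) in B-form modulo a budget -/

section Budget

variable [IsAlgClosed k]

/-- **REGIME (P) IN B-FORM MODULO THE BUDGET** (`k` algebraically closed): given a conflict budget `M` for the lazy selector with its two laws, every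
admissible state of the `o ≥ 2` phase outside the apex column with an old letter or in good position is B-won towards «head drop, or same head in the
apex column». -/
theorem regimePresentedB_of_budget (M : (d : ℕ) → (Fin d → MvPowerSeries (Fin 2) k) → Finset (Fin 2) → ℕ)
    (hM_succ : ∀ (d : ℕ) (A : Fin d → MvPowerSeries (Fin 2) k) (N : Finset (Fin 2)) (A' : Fin d → MvPowerSeries (Fin 2) k)
      (N' : Finset (Fin 2)),
      (∃ (b : MvPowerSeries (Fin (2 + 1)) k) (δ : Decoration k 2) (Θ : Fin (2 + 1) → MvPowerSeries (Fin (2 + 1)) k),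
        Admissible b δ ∧ 2 ≤ δ.o ∧ δ.c = d ∧ δ.PresBy d A N Θ) →
      InPoly d A → InPoly d A' → SuccFamilySel d (prepSelWP d) A N A' N' → M d A' N' ≤ M d A N)
    (hM_conf : ∀ (d : ℕ) (A : Fin d → MvPowerSeries (Fin 2) k) (N : Finset (Fin 2)) (A' : Fin d → MvPowerSeries (Fin 2) k)
      (N' : Finset (Fin 2)),
      (∃ (b : MvPowerSeries (Fin (2 + 1)) k) (δ : Decoration k 2) (Θ : Fin (2 + 1) → MvPowerSeries (Fin (2 + 1)) k),
        Admissible b δ ∧ 2 ≤ δ.o ∧ δ.c = d ∧ δ.PresBy d A N Θ) →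
      InPoly d A → InPoly d A' → NCPoly.Conflict d A N → PointFamilySel d (prepSelWP d) A N A' N' → M d A' N' < M d A N)
    (b : MvPowerSeries (Fin (2 + 1)) k) (δ : Decoration k 2) (hadm : Admissible b δ) (ho : 2 ≤ δ.o) (hnc : ¬ δ.HCol)
    (hreg : δ.O.Nonempty ∨ δ.GoodDir) :
    DBWinsTo (fun τ : MvPowerSeries (Fin (2 + 1)) k × Decoration k 2 => Admissible τ.1 τ.2 ∧ (τ.2.head < δ.head ∨ (τ.2.head = δ.head ∧ τ.2.HCol)))
      (b, δ) :=
  regimePresentedB_of_pieces₂ (fun d => prepSelWP d) (fun d X hX => isPrepRecentring_prepSelWP_all d X hX) M hM_succ hM_conf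
    (fun _ _ hadm ho hnot h => Decoration.exists_presBy_of_presented hadm ho hnot h)
    (fun _ _ _ _ _ _ hadm ho hcd hpres hWP hn => Decoration.hCol_of_presBy_of_not_inPoly hadm ho hcd hpres hWP hn)
    (fun _ _ _ _ _ _ hadm ho hcd h hin hconf => h.exists_bmove_of_not_conflict hadm ho hcd hin hconf)
    (fun _ _ _ _ _ _ hadm ho hcd h hin _ => h.exists_bmove_point hadm ho hcd hin) b δ hadm ho hnc hreg

/-- **REGIME (L) IN B-FORM MODULO THE BUDGET** (`k` algebraically closed): the same budget B-wins the letter regime towards «head drop, or same head in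
the apex column / good position / bad position». -/
theorem regimeLetterB_of_budget (M : (d : ℕ) → (Fin d → MvPowerSeries (Fin 2) k) → Finset (Fin 2) → ℕ)
    (hM_succ : ∀ (d : ℕ) (A : Fin d → MvPowerSeries (Fin 2) k) (N : Finset (Fin 2)) (A' : Fin d → MvPowerSeries (Fin 2) k)
      (N' : Finset (Fin 2)),
      (∃ (b : MvPowerSeries (Fin (2 + 1)) k) (δ : Decoration k 2) (Θ : Fin (2 + 1) → MvPowerSeries (Fin (2 + 1)) k),
        Admissible b δ ∧ 2 ≤ δ.o ∧ δ.c = d ∧ δ.PresBy d A N Θ) →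
      InPoly d A → InPoly d A' → SuccFamilySel d (prepSelWP d) A N A' N' → M d A' N' ≤ M d A N)
    (hM_conf : ∀ (d : ℕ) (A : Fin d → MvPowerSeries (Fin 2) k) (N : Finset (Fin 2)) (A' : Fin d → MvPowerSeries (Fin 2) k)
      (N' : Finset (Fin 2)),
      (∃ (b : MvPowerSeries (Fin (2 + 1)) k) (δ : Decoration k 2) (Θ : Fin (2 + 1) → MvPowerSeries (Fin (2 + 1)) k),
        Admissible b δ ∧ 2 ≤ δ.o ∧ δ.c = d ∧ δ.PresBy d A N Θ) →
      InPoly d A → InPoly d A' → NCPoly.Conflict d A N → PointFamilySel d (prepSelWP d) A N A' N' → M d A' N' < M d A N)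
    (b : MvPowerSeries (Fin (2 + 1)) k) (δ : Decoration k 2) (hadm : Admissible b δ) (ho : 2 ≤ δ.o) {l : Fin (2 + 1)}
    (hl : δ.LetterDir l) :
    DBWinsTo (fun τ : MvPowerSeries (Fin (2 + 1)) k × Decoration k 2 =>
      Admissible τ.1 τ.2 ∧ (τ.2.head < δ.head ∨ (τ.2.head = δ.head ∧ (τ.2.HCol ∨ τ.2.GoodDir ∨ τ.2.BadDir)))) (b, δ) :=
  regimeLetterB_of_pieces (fun d => prepSelWP d) (fun d X hX => isPrepRecentring_prepSelWP_all d X hX) M hM_succ hM_conf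
    (fun _ _ hadm ho hnot h => Decoration.exists_presBy_of_presented hadm ho hnot h)
    (fun _ _ _ _ _ _ hadm ho hcd hpres hWP hn => Decoration.hCol_of_presBy_of_not_inPoly hadm ho hcd hpres hWP hn)
    (fun _ _ _ _ _ _ hadm ho hcd h hin hconf => h.exists_bmove_of_not_conflict hadm ho hcd hin hconf)
    (fun _ _ _ _ _ _ hadm ho hcd h hin _ => h.exists_bmove_point hadm ho hcd hin) b δ hadm ho hl

end Budget

/-! ## Unconditionally, over an algebraically closed field of prime characteristic -/

/-- **REGIME (P) IN B-PERMISSIBLE FORM** — the hypothesis `hP` of `surfaceBoundaryNC_of_regimesB`, verbatim: over an algebraically closed field of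
characteristic `p`, every admissibly decorated position of the `o ≥ 2` phase outside the apex column, with an old letter or in good position, is B-won
(B-permissible moves, the TRANSFORM as successor) towards «head drop, or same head in the apex column».  The budget is res-type-088's
`stub_conflictBudget`. -/
theorem regimePresentedB (p : ℕ) [Fact p.Prime] [CharP k p] [IsAlgClosed k] :
    ∀ (b : MvPowerSeries (Fin (2 + 1)) k) (δ : Decoration k 2), Admissible b δ → 2 ≤ δ.o → ¬ δ.HCol →
      (δ.O.Nonempty ∨ δ.GoodDir) →
      DBWinsTo (fun τ => Admissible τ.1 τ.2 ∧ (τ.2.head < δ.head ∨ (τ.2.head = δ.head ∧ τ.2.HCol))) (b, δ) := by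
  intro b δ hadm ho hnc hreg
  obtain ⟨M, hM_succ, hM_conf⟩ := stub_conflictBudget p Fact.out k
  exact regimePresentedB_of_budget M hM_succ hM_conf b δ hadm ho hnc hreg

/-- **REGIME (L) IN B-PERMISSIBLE FORM** — the hypothesis `hL` of `surfaceBoundaryNC_of_regimesB`, verbatim (the apex-column hypothesis is idle: a
letter directrix is never in the apex column, but the binder is kept for the interface). -/
theorem regimeLetterB (p : ℕ) [Fact p.Prime] [CharP k p] [IsAlgClosed k] :
    ∀ (b : MvPowerSeries (Fin (2 + 1)) k) (δ : Decoration k 2) (l : Fin (2 + 1)), Admissible b δ → 2 ≤ δ.o → ¬ δ.HCol →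
      δ.LetterDir l →
      DBWinsTo (fun τ => Admissible τ.1 τ.2 ∧ (τ.2.head < δ.head ∨ (τ.2.head = δ.head ∧ (τ.2.HCol ∨ τ.2.GoodDir ∨ τ.2.BadDir)))) (b, δ) := by
  intro b δ l hadm ho _ hl
  obtain ⟨M, hM_succ, hM_conf⟩ := stub_conflictBudget p Fact.out k
  exact regimeLetterB_of_budget M hM_succ hM_conf b δ hadm ho hl

/-- **D₃ᴮ MODULO (H), (B) AND THE ENDGAME**: with regimes (P) and (L) now tree theorems in B-form, `surfaceBoundaryNC_of_regimesB` needs only the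
apex-column regime `hH`, the bad-direction regime `hB` and the `o ≤ 1` endgame `hend` (hands B, C, D of the D₃ᴮ order of record). -/
theorem surfaceBoundaryNC_of_regimesB₃ (p : ℕ) [Fact p.Prime] [CharP k p] [IsAlgClosed k]
    (hH : ∀ (b : MvPowerSeries (Fin (2 + 1)) k) (δ : Decoration k 2), Admissible b δ → 2 ≤ δ.o → δ.HCol →
      DBWinsTo (fun τ => Admissible τ.1 τ.2 ∧ τ.2.head < δ.head) (b, δ))
    (hB : ∀ (b : MvPowerSeries (Fin (2 + 1)) k) (δ : Decoration k 2), Admissible b δ → 2 ≤ δ.o → ¬ δ.HCol → δ.BadDir →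
      DBWinsTo (fun τ => Admissible τ.1 τ.2 ∧ (τ.2.head < δ.head ∨ (τ.2.head = δ.head ∧ (τ.2.HCol ∨ τ.2.GoodDir)))) (b, δ))
    (hend : ∀ (b : MvPowerSeries (Fin (2 + 1)) k) (δ : Decoration k 2), Admissible b δ → δ.o ≤ 1 →
      DBWinsTo (fun τ => GermIsNC τ.1 ∨ (Admissible τ.1 τ.2 ∧ τ.2.head < δ.head)) (b, δ))
    (b : MvPowerSeries (Fin (2 + 1)) k) (δ : Decoration k 2) (hadm : Admissible b δ) :
    DBWinsTo (fun τ : MvPowerSeries (Fin (2 + 1)) k × Decoration k 2 => GermIsNC τ.1) (b, δ) :=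
  surfaceBoundaryNC_of_regimesB p hH (regimePresentedB p) (regimeLetterB p) hB hend b δ hadm

end TameFourTupleDrop

end Summit.ResolutionOfSingularities.ResolutionOfSingularities.Theorems

end
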